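import Mathlib.Analysis.SpecialFunctions.Gaussian.FourierTransform
import Mathlib.Analysis.SpecialFunctions.Sqrt
import Mathlib.Analysis.Calculus.Deriv.MeanValue

/-!
# Crux `AdaptedKernelExists` (stmt-NavierStokesRegularity-2956), line `nash-entropy-last-block`:
  the GAUSSIAN ENVELOPE ESTIMATES and the ODE COMPARISON for STUB `stub_expMoment`

Helper file (lands `--supports stmt-NavierStokesRegularity-2956`) for the registered stub
`stub_expMoment` of the line's skeleton (the exponential moment law for an adapted backward
kernel of a Type-I divergence-free drift). Pure real analysis, no kernels:

* `expMoment_envelope_pointwise`: Gaussian beats exponential — under the envelope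
  `g ≤ K τ^{-3/2} e^{−‖y‖²/(aτ)}` and off the ball `‖y‖ ≥ R`,
  `e^{⟨α, y⟩} g ≤ |K| τ^{-3/2} e^{‖α‖² a τ/2} e^{−R²/(4aτ)} e^{−‖y‖²/(4aτ)}` (complete the square);
* `expMoment_integrable_gaussian`, `expMoment_integral_gaussian`: the translated Gaussian
  `e^{−‖x − x₀‖²/β}` is integrable on `ℝ³` and `∫ τ^{-3/2} e^{−‖x − x₀‖²/(4aτ)} dx = (4πa)^{3/2}`
  (Mathlib `GaussianFourier.integral_rexp_neg_mul_sq_norm`);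
* `expMoment_ode`: the ODE comparison behind the moment law — if `M′ ≥ −k M − (P/√(T−s) + Q) ε`
  on `[t, T)` with `k(s) = C′/√(T−s) + n′` and `M(s) → 1` as `s ↑ T`, then
  `M(t) ≤ e^{n′(T−t) + 2C′√(T−t)} (1 + ε (Q (T−t) + 2P √(T−t)))` (integrating factor
  `e^{−K(s)}`, `K(s) = ∫ₛᵀ k = 2C′√(T−s) + n′(T−s)`, monotonicity of
  `M e^{−K} + ε (Q s − 2P√(T−s))`, and the limit `s ↑ T`);
* `expMoment_stub_ode`: its closed `∀`-form, the registered sub-goal of the crux item for this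
  helper file.
-/

noncomputable section

open MeasureTheory Set Filter Topology Metric Function
open scoped RealInnerProductSpace

namespace Summit.NavierStokesRegularity.NavierStokesRegularity.Theorems.AdaptedKernelExists.NashEntropyLastBlock

/-! ### Gaussian beats exponential: the pointwise envelope bound -/

section Pointwise

variable {E : Type*} [NormedAddCommGroup E] [InnerProductSpace ℝ E]

/-- **Gaussian beats exponential.** If `g ≤ K τ^{-3/2} e^{−‖y‖²/(aτ)}` (`a, τ > 0`) and
`R ≤ ‖y‖` (`R ≥ 0`), then
`e^{⟨α, y⟩} g ≤ |K| τ^{-3/2} e^{‖α‖² a τ / 2} e^{−R²/(4aτ)} e^{−‖y‖²/(4aτ)}`: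
`⟨α, y⟩ ≤ ‖α‖‖y‖ ≤ ‖α‖² aτ/2 + ‖y‖²/(2aτ)` and `‖y‖²/(2aτ) ≥ R²/(4aτ) + ‖y‖²/(4aτ)`. -/
theorem expMoment_envelope_pointwise {K a τ R g : ℝ} {α y : E} (ha : 0 < a) (hτ : 0 < τ)
    (hR : 0 ≤ R) (hy : R ≤ ‖y‖)
    (hg : g ≤ K * τ ^ (-(3:ℝ) / 2) * Real.exp (-(‖y‖ ^ 2) / (a * τ))) :
    Real.exp ⟪α, y⟫ * g ≤ |K| * τ ^ (-(3:ℝ) / 2) * Real.exp (‖α‖ ^ 2 * a * τ / 2) *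
      Real.exp (-(R ^ 2) / (4 * a * τ)) * Real.exp (-(‖y‖ ^ 2) / (4 * a * τ)) := by
  have hτp : 0 ≤ τ ^ (-(3:ℝ) / 2) := (Real.rpow_pos_of_pos hτ _).le
  have h1 : g ≤ |K| * τ ^ (-(3:ℝ) / 2) * Real.exp (-(‖y‖ ^ 2) / (a * τ)) :=
    hg.trans (mul_le_mul_of_nonneg_right (mul_le_mul_of_nonneg_right (le_abs_self K) hτp)
      (Real.exp_pos _).le)
  have h2 : ⟪α, y⟫ + -(‖y‖ ^ 2) / (a * τ) ≤
      ‖α‖ ^ 2 * a * τ / 2 + -(R ^ 2) / (4 * a * τ) + -(‖y‖ ^ 2) / (4 * a * τ) := by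
    have hin : ⟪α, y⟫ ≤ ‖α‖ * ‖y‖ := real_inner_le_norm α y
    have hR2 : R ^ 2 ≤ ‖y‖ ^ 2 := pow_le_pow_left₀ hR hy 2
    have ha' : a ≠ 0 := ha.ne'
    have hτ' : τ ≠ 0 := hτ.ne'
    rw [← sub_nonneg]
    have hdiff : ‖α‖ ^ 2 * a * τ / 2 + -(R ^ 2) / (4 * a * τ) + -(‖y‖ ^ 2) / (4 * a * τ) -
        (⟪α, y⟫ + -(‖y‖ ^ 2) / (a * τ)) =
        (2 * (‖α‖ * (a * τ) - ‖y‖) ^ 2 + (‖y‖ ^ 2 - R ^ 2) + 4 * (a * τ) * (‖α‖ * ‖y‖ - ⟪α, y⟫)) /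
          (4 * (a * τ)) := by
      field_simp
      ring
    rw [hdiff]
    have hA : 0 ≤ 4 * (a * τ) * (‖α‖ * ‖y‖ - ⟪α, y⟫) :=
      mul_nonneg (by positivity) (sub_nonneg.2 hin)
    exact div_nonneg (by nlinarith [sq_nonneg (‖α‖ * (a * τ) - ‖y‖), hA, hR2]) (by positivity)
  calc Real.exp ⟪α, y⟫ * g
      ≤ Real.exp ⟪α, y⟫ * (|K| * τ ^ (-(3:ℝ) / 2) * Real.exp (-(‖y‖ ^ 2) / (a * τ))) :=
        mul_le_mul_of_nonneg_left h1 (Real.exp_pos _).le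
    _ = |K| * τ ^ (-(3:ℝ) / 2) * Real.exp (⟪α, y⟫ + -(‖y‖ ^ 2) / (a * τ)) := by
        rw [Real.exp_add]; ring
    _ ≤ |K| * τ ^ (-(3:ℝ) / 2) *
          Real.exp (‖α‖ ^ 2 * a * τ / 2 + -(R ^ 2) / (4 * a * τ) + -(‖y‖ ^ 2) / (4 * a * τ)) := by
        gcongr
    _ = _ := by rw [Real.exp_add, Real.exp_add]; ring

end Pointwise

/-! ### Gaussian integrals on `ℝ³` -/

section Gauss

/-- The translated Gaussian `x ↦ e^{−‖x − x₀‖²/β}` (`β > 0`) is integrable on `ℝ³` (its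
untranslated integral is the positive number `(πβ)^{3/2}`). -/
theorem expMoment_integrable_gaussian {β : ℝ} (hβ : 0 < β) (x₀ : EuclideanSpace ℝ (Fin 3)) :
    Integrable fun x : EuclideanSpace ℝ (Fin 3) => Real.exp (-(‖x - x₀‖ ^ 2) / β) := by
  have h1 : Integrable fun v : EuclideanSpace ℝ (Fin 3) => Real.exp (-β⁻¹ * ‖v‖ ^ 2) := by
    by_contra h
    have h2 :=
      GaussianFourier.integral_rexp_neg_mul_sq_norm (V := EuclideanSpace ℝ (Fin 3)) (inv_pos.2 hβ)
    rw [integral_undef h] at h2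
    have h3 : (0:ℝ) <
        (Real.pi / β⁻¹) ^ ((Module.finrank ℝ (EuclideanSpace ℝ (Fin 3)) : ℝ) / 2) := by
      positivity
    exact h3.ne h2
  refine (h1.comp_sub_right x₀).congr (Eventually.of_forall fun x => ?_)
  simp only
  congr 1
  ring

/-- The normalised Gaussian integral on `ℝ³`:
`∫ τ^{-3/2} e^{−‖x − x₀‖²/(4aτ)} dx = (4πa)^{3/2}` (`a, τ > 0`). -/
theorem expMoment_integral_gaussian {a τ : ℝ} (ha : 0 < a) (hτ : 0 < τ)
    (x₀ : EuclideanSpace ℝ (Fin 3)) :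
    ∫ x : EuclideanSpace ℝ (Fin 3), τ ^ (-(3:ℝ) / 2) * Real.exp (-(‖x - x₀‖ ^ 2) / (4 * a * τ)) =
      (4 * Real.pi * a) ^ ((3:ℝ) / 2) := by
  have hβ : 0 < 1 / (4 * a * τ) := by positivity
  rw [integral_const_mul,
    integral_sub_right_eq_self
      (fun v : EuclideanSpace ℝ (Fin 3) => Real.exp (-(‖v‖ ^ 2) / (4 * a * τ))) x₀]
  have h2 : (fun v : EuclideanSpace ℝ (Fin 3) => Real.exp (-(‖v‖ ^ 2) / (4 * a * τ))) =
      fun v => Real.exp (-(1 / (4 * a * τ)) * ‖v‖ ^ 2) := by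
    funext v; congr 1; ring
  rw [h2, GaussianFourier.integral_rexp_neg_mul_sq_norm hβ]
  simp only [finrank_euclideanSpace_fin, Nat.cast_ofNat]
  rw [show Real.pi / (1 / (4 * a * τ)) = (4 * Real.pi * a) * τ by field_simp,
    Real.mul_rpow (by positivity) hτ.le]
  have h4 : τ ^ (-(3:ℝ) / 2) * τ ^ ((3:ℝ) / 2) = 1 := by
    rw [← Real.rpow_add hτ]; norm_num
  calc τ ^ (-(3:ℝ) / 2) * ((4 * Real.pi * a) ^ ((3:ℝ) / 2) * τ ^ ((3:ℝ) / 2))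
      = (4 * Real.pi * a) ^ ((3:ℝ) / 2) * (τ ^ (-(3:ℝ) / 2) * τ ^ ((3:ℝ) / 2)) := by ring
    _ = _ := by rw [h4, mul_one]

end Gauss

/-! ### The ODE comparison -/

/-- **ODE comparison behind the exponential moment law.** Let `t < T`, `C′, n′, P, Q, ε ≥ 0`,
and let `M` be differentiable on `[t, T)` with derivative `m`, with
`m(s) ≥ −(C′/√(T − s) + n′) M(s) − (P/√(T − s) + Q) ε` there and `M(s) → 1` as `s ↑ T`. Then
`M(t) ≤ e^{n′(T − t) + 2C′√(T − t)} (1 + ε (Q (T − t) + 2P √(T − t)))`.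
Proof: with `K(s) = 2C′√(T − s) + n′(T − s)` (`K′ = −C′/√(T − s) − n′`, `K ≥ 0`, `K(T) = 0`)
the function `J(s) = M(s) e^{−K(s)} + ε (Q s − 2P√(T − s))` has
`J′ = (m + (C′/√(T − s) + n′) M) e^{−K} + ε (Q + P/√(T − s)) ≥ (P/√(T − s) + Q) ε (1 − e^{−K}) ≥ 0`,
so `J(t) ≤ lim_{s ↑ T} J(s) = 1 + ε Q T`. -/
theorem expMoment_ode {t T C' n' P Q ε : ℝ} {M m : ℝ → ℝ} (htT : t < T) (hC' : 0 ≤ C')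
    (hn' : 0 ≤ n') (hP : 0 ≤ P) (hQ : 0 ≤ Q) (hε : 0 ≤ ε)
    (hderiv : ∀ s ∈ Ico t T, HasDerivAt M (m s) s)
    (hineq : ∀ s ∈ Ico t T,
      -(C' / Real.sqrt (T - s) + n') * M s - (P / Real.sqrt (T - s) + Q) * ε ≤ m s)
    (hlim : Tendsto M (𝓝[<] T) (𝓝 1)) :
    M t ≤ Real.exp (n' * (T - t) + 2 * C' * Real.sqrt (T - t)) *
      (1 + ε * (Q * (T - t) + 2 * P * Real.sqrt (T - t))) := by
  -- the integrating factor and the comparison function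
  obtain ⟨Kf, hKf⟩ : ∃ Kf : ℝ → ℝ, Kf = fun s => 2 * C' * Real.sqrt (T - s) + n' * (T - s) :=
    ⟨_, rfl⟩
  obtain ⟨J, hJ⟩ : ∃ J : ℝ → ℝ,
      J = fun s => M s * Real.exp (-Kf s) + ε * (Q * s - 2 * P * Real.sqrt (T - s)) := ⟨_, rfl⟩
  have hsqrt : ∀ s, s < T →
      HasDerivAt (fun r => Real.sqrt (T - r)) (-(1 / (2 * Real.sqrt (T - s)))) s := by
    intro s hs
    have h := ((hasDerivAt_id' s).const_sub T).sqrt (sub_pos.2 hs).ne'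
    refine h.congr_deriv ?_
    ring
  have hKf' : ∀ s, s < T → HasDerivAt Kf (-(C' / Real.sqrt (T - s) + n')) s := by
    intro s hs
    have hsq0 : Real.sqrt (T - s) ≠ 0 := (Real.sqrt_pos.2 (sub_pos.2 hs)).ne'
    rw [hKf]
    have h := ((hsqrt s hs).const_mul (2 * C')).add
      (((hasDerivAt_id' s).const_sub T).const_mul n')
    refine h.congr_deriv ?_
    field_simp
    ring
  have hKf0 : ∀ s, s ≤ T → 0 ≤ Kf s := fun s hs => by
    have h0 : 0 ≤ T - s := sub_nonneg.2 hs
    rw [hKf]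
    positivity
  have hKfT : Kf T = 0 := by rw [hKf]; simp
  -- the derivative of `J`
  have hJ' : ∀ s ∈ Ico t T, HasDerivAt J
      ((m s + (C' / Real.sqrt (T - s) + n') * M s) * Real.exp (-Kf s) +
        ε * (Q + P / Real.sqrt (T - s))) s := by
    intro s hs
    have hs' : s < T := hs.2
    have hsq0 : Real.sqrt (T - s) ≠ 0 := (Real.sqrt_pos.2 (sub_pos.2 hs')).ne'
    have h0 : HasDerivAt (fun r => -Kf r) (-(-(C' / Real.sqrt (T - s) + n'))) s :=
      (hKf' s hs').neg
    have h1 : HasDerivAt (fun r => Real.exp (-Kf r))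
        (Real.exp (-Kf s) * (C' / Real.sqrt (T - s) + n')) s := by
      refine h0.exp.congr_deriv ?_
      ring
    have h2 := (hderiv s hs).mul h1
    have h3 : HasDerivAt (fun r => ε * (Q * r - 2 * P * Real.sqrt (T - r)))
        (ε * (Q * 1 - 2 * P * -(1 / (2 * Real.sqrt (T - s))))) s :=
      (((hasDerivAt_id s).const_mul Q).sub ((hsqrt s hs').const_mul (2 * P))).const_mul ε
    rw [hJ]
    refine (h2.add h3).congr_deriv ?_
    field_simp
    ring
  -- `J' ≥ 0`
  have hJ'0 : ∀ s ∈ Ico t T, 0 ≤ (m s + (C' / Real.sqrt (T - s) + n') * M s) * Real.exp (-Kf s) +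
      ε * (Q + P / Real.sqrt (T - s)) := by
    intro s hs
    have hk := hineq s hs
    have hcoef : 0 ≤ (P / Real.sqrt (T - s) + Q) * ε := by positivity
    have hexp1 : Real.exp (-Kf s) ≤ 1 := by
      rw [Real.exp_le_one_iff]
      linarith [hKf0 s hs.2.le]
    have hexp0 : 0 ≤ Real.exp (-Kf s) := (Real.exp_pos _).le
    have h1 : -((P / Real.sqrt (T - s) + Q) * ε) ≤
        m s + (C' / Real.sqrt (T - s) + n') * M s := by linarith
    nlinarith [mul_le_mul_of_nonneg_right h1 hexp0, mul_le_mul_of_nonneg_left hexp1 hcoef]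
  -- `J` is monotone on `[t, T)`
  have hmono : MonotoneOn J (Ico t T) := by
    have hcont : ContinuousOn J (Ico t T) := fun s hs =>
      (hJ' s hs).continuousAt.continuousWithinAt
    have hdiff : DifferentiableOn ℝ J (interior (Ico t T)) := by
      rw [interior_Ico]
      exact fun s hs => (hJ' s (Ioo_subset_Ico_self hs)).differentiableAt.differentiableWithinAt
    refine monotoneOn_of_deriv_nonneg (convex_Ico t T) hcont hdiff fun s hs => ?_
    rw [interior_Ico] at hs
    rw [(hJ' s (Ioo_subset_Ico_self hs)).deriv]
    exact hJ'0 s (Ioo_subset_Ico_self hs)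
  -- the limit of `J` at `T⁻`
  have hJlim : Tendsto J (𝓝[<] T) (𝓝 (1 + ε * (Q * T))) := by
    have h1 : Tendsto (fun s => Real.exp (-Kf s)) (𝓝[<] T) (𝓝 1) := by
      have hc : Continuous fun s => Real.exp (-Kf s) := by rw [hKf]; fun_prop
      have := (hc.tendsto T).mono_left (nhdsWithin_le_nhds (s := Iio T))
      rwa [hKfT, neg_zero, Real.exp_zero] at this
    have h2 : Tendsto (fun s => ε * (Q * s - 2 * P * Real.sqrt (T - s))) (𝓝[<] T)
        (𝓝 (ε * (Q * T))) := by
      have hc : Continuous fun s => ε * (Q * s - 2 * P * Real.sqrt (T - s)) := by fun_prop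
      have := (hc.tendsto T).mono_left (nhdsWithin_le_nhds (s := Iio T))
      rwa [sub_self, Real.sqrt_zero, mul_zero, sub_zero] at this
    have := (hlim.mul h1).add h2
    rw [one_mul] at this
    rw [hJ]
    exact this
  -- `J t ≤ lim J`
  have hJt : J t ≤ 1 + ε * (Q * T) := by
    refine ge_of_tendsto hJlim ?_
    filter_upwards [Ico_mem_nhdsLT htT] with s hs
    exact hmono (left_mem_Ico.2 htT) hs hs.1
  rw [hJ] at hJt
  have hJt' : M t * Real.exp (-Kf t) ≤ 1 + ε * (Q * (T - t) + 2 * P * Real.sqrt (T - t)) := by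
    simp only at hJt
    nlinarith [hJt]
  -- remove the integrating factor
  have hexpK : Real.exp (n' * (T - t) + 2 * C' * Real.sqrt (T - t)) = Real.exp (Kf t) := by
    rw [hKf]
    congr 1
    ring
  have hpos : 0 < Real.exp (Kf t) := Real.exp_pos _
  have hid : M t = (M t * Real.exp (-Kf t)) * Real.exp (Kf t) := by
    rw [Real.exp_neg, mul_assoc, inv_mul_cancel₀ hpos.ne', mul_one]
  rw [hexpK, hid]
  calc M t * Real.exp (-Kf t) * Real.exp (Kf t)
      ≤ (1 + ε * (Q * (T - t) + 2 * P * Real.sqrt (T - t))) * Real.exp (Kf t) :=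
        mul_le_mul_of_nonneg_right hJt' hpos.le
    _ = _ := by ring

/-- **Registered sub-goal `expMoment_stub_ode`** (the closed form of `expMoment_ode`, a sub-goal
of STUB `stub_expMoment`): the ODE comparison `M′ ≥ −(C′/√(T−s) + n′) M − (P/√(T−s) + Q) ε`
on `[t, T)`, `M → 1` at `T⁻`, implies
`M(t) ≤ e^{n′(T−t) + 2C′√(T−t)} (1 + ε (Q (T−t) + 2P√(T−t)))`. -/
theorem expMoment_stub_ode :
    ∀ (t T C' n' P Q ε : ℝ) (M m : ℝ → ℝ), t < T → 0 ≤ C' → 0 ≤ n' → 0 ≤ P → 0 ≤ Q → 0 ≤ ε → (∀ s ∈ Ico t T, HasDerivAt M (m s) s) → (∀ s ∈ Ico t T, -(C' / Real.sqrt (T - s) + n') * M s - (P / Real.sqrt (T - s) + Q) * ε ≤ m s) → Tendsto M (𝓝[<] T) (𝓝 1) → M t ≤ Real.exp (n' * (T - t) + 2 * C' * Real.sqrt (T - t)) * (1 + ε * (Q * (T - t) + 2 * P * Real.sqrt (T - t))) :=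
  fun _ _ _ _ _ _ _ _ _ htT hC' hn' hP hQ hε hd hi hl => expMoment_ode htT hC' hn' hP hQ hε hd hi hl

end Summit.NavierStokesRegularity.NavierStokesRegularity.Theorems.AdaptedKernelExists.NashEntropyLastBlock

end
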